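import Summits.QuantumAdvantage.QuantumAdvantage.Theses.ThirdFactorialPincer
import Literature.NumberTheory.GaussSums.KummerSector
import Literature.Computability.Complexity.Oracle
import Literature.Computability.Cryptography.ShorAssemblyLeavesProofs

/-!
# QuantumAdvantage / ThirdFactorialPincer — `ArgLeg` from four sub-cruxes (stmt-QuantumAdvantage-14637)

The argument leg `ArgLeg` ("arg S_p to ±1/2 rad, as 7 bits, is `IsQSolvable`") follows from

* `X₁` (quantum)   `Literature.NumberTheory.GaussSums.KummerSector ∈ BQP` — Kummer's sector of the cubic
  Gauss sum `g(χ_{p,g})` is decidable in bounded-error quantum polynomial time (van Dam–Seroussi 2002, Thm 1,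
  plus the classical candidates `arg(π)/3 + 2πk/3`);
* `X₂` (algebraic) `g(χ_{p,g})³ = p·π` for the PRIMARY prime `π = a + bω` of norm `p` dividing
  `g^{(p-1)/3} − ω` (Ireland–Rosen 1990, Ch. 9 §4, Lemma 1 and Corollary; noted as missing in
  `Literature/NumberTheory/GaussSums/KummerSector.lean`);
* `X₃` (analytic, a FINITE identity) `12·p·S_p = √3 · g(χ_p) · T_p` with
  `T_p = Σ_{0<a<3p} θ̄(a) cot(πa/3p)`, `θ̄ = χ̄_p ψ₃` the odd sextic character mod `3p`
  (Pólya's Fourier expansion of the partial character sum `S_p = Σ_{0<j<p/3} χ_p(j)`, equivalently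
  Urbanowicz–Williams 2000 Ch. I Thm 2 `S_p = (√3/2π) g(χ_p) L(1, θ̄)` with the cotangent formula
  `L(1, θ̄) = (π/6p) T_p`; checked numerically to `1e-12` for the 271 primes `p ≡ 1 (3)` below `4000`);
* `X₄` (classical) a polynomial-time oracle algorithm with coins, relative to the Kummer-sector LANGUAGE, which on
  input `x` (prime `p = decodeNat x ≡ 1 (3)`) outputs with probability `≥ 3/4` the 7 bits of `(n₂ + n₃) mod 72`
  together with a CERTIFICATE: a primitive root `g` with `g^{(p-1)/3} ≡ r`, its sector `k`, the primary
  `π ∣ g^{(p-1)/3} − ω`, an index `n₃` with `|arg π/3 + 2πk/3 − 2πn₃/72| ≤ π/36 (mod 2π)` and an index `n₂`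
  with `|arg(T_p · e^{−2πi n₂/72})| ≤ π/8` (Euclid in `ℤ[ω]`; Monte-Carlo dyadic sampling of `Σ θ̄(n)/n`,
  Pólya–Vinogradov tail, Landau's lower bound `|L(1, θ̄)| ≫ 1/log 3p` — all inside the PROOF of `X₄`),

by (i) pinning the Gauss sum in polar form `g(χ) = ‖g‖·e^{i(arg π/3 + 2πk/3)}` from `X₂`, `g ≠ 0` and the
sector (cube roots of unity + `kummerSectorIndex_eq_iff`), (ii) transporting the certified angle of `T_p` to
`S_p · conj g(χ_p)` through `X₃` and `g · conj g = p` (`arg_transfer`), (iii) adding the two certified angles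
(`π/36 + π/8 = 11π/72 < 1/2`), (iv) closure of the `ArgLeg` relation under extension of the read-out, and
(v) the tree's PROVED classical-base principle `isQSolvable_of_mem_FPRel_BQP_holds`
("`BPP^{A}` search problems, `A ∈ BQP`, are `IsQSolvable`": Bennett–Bernstein–Brassard–Vazirani 1997 Cor. 4.15
with Bernstein–Vazirani 1997 Thm 8.3) applied with `A = KummerSector` from `X₁`.
-/

set_option linter.dupNamespace false

namespace Summit.QuantumAdvantage.QuantumAdvantage.Theorems.ThirdFactorialPincer

open _root_.Computability Complex
open Literature.Computability.Complexity Literature.Computability.Cryptography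
open Literature.NumberTheory.GaussSums

/-! ### Angle lemmas -/

/-- `11π/72 ≤ 1/2`. [folklore] -/
theorem eleven_pi_div_le_half : Real.pi / 36 + Real.pi / 8 ≤ 1 / 2 := by
  have := Real.pi_lt_d2
  norm_num at this ⊢
  linarith

/-- Polar form of the cubic Gauss sum from its cube and its Kummer sector: if `g(χ)³ = p·π` with `π ≠ 0`
and the sector index is `k`, then `g(χ) = ‖g(χ)‖ · exp(i (arg π / 3 + 2πk/3))`.
[cite: IrelandRosen1990, Ch. 9 §12 (Kummer's problem: g(χ) = ω^k · principal cube root of pπ)] -/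
theorem gaussSum_polar {p g : ℕ} [Fact p.Prime] (h3 : p % 3 = 1)
    (hg : IsPrimitiveRoot (g : ZMod p) (p - 1)) {π : ℂ} (_hπ : π ≠ 0)
    (hcube : cubicGaussSum p g ^ 3 = (p : ℂ) * π) {k : ℕ}
    (hk : (kummerSectorIndex p g : ℕ) = k) :
    cubicGaussSum p g =
      (‖cubicGaussSum p g‖ : ℂ) * exp (((arg π / 3 + 2 * Real.pi * k / 3 : ℝ) : ℂ) * I) := by
  set G₀ := cubicGaussSum p g with hG₀def
  have hG0 : G₀ ≠ 0 := cubicGaussSum_ne_zero h3 hg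
  set R : ℝ := ‖G₀‖ with hRdef
  have hR : 0 < R := norm_pos_iff.mpr hG0
  set ψ : ℝ := arg π with hψdef
  -- norms: R³ = p ‖π‖
  have hnorm : R ^ 3 = (p : ℝ) * ‖π‖ := by
    have := congrArg (fun z : ℂ => ‖z‖) hcube
    simpa [norm_pow, norm_mul, Complex.norm_natCast] using this
  -- the principal cube root ρ of pπ
  set ρ : ℂ := (R : ℂ) * exp (((ψ / 3 : ℝ) : ℂ) * I) with hρdef
  have hρ3 : ρ ^ 3 = G₀ ^ 3 := by
    have h1 : ρ ^ 3 = ((R ^ 3 : ℝ) : ℂ) * exp ((ψ : ℂ) * I) := by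
      rw [hρdef, mul_pow, ← Complex.exp_nat_mul]
      push_cast
      ring_nf
    rw [h1, hcube, hnorm]
    push_cast
    rw [mul_assoc, hψdef, norm_mul_exp_arg_mul_I π]
  have hρ0 : ρ ≠ 0 := by
    rw [hρdef]
    exact mul_ne_zero (by exact_mod_cast hR.ne') (Complex.exp_ne_zero _)
  -- G₀ / ρ is a cube root of unity
  have hunit : (G₀ / ρ) ^ 3 = 1 := by
    rw [div_pow, ← hρ3, div_self (pow_ne_zero 3 hρ0)]
  obtain ⟨i, hi, hωi⟩ := omega_isPrimitiveRoot.eq_pow_of_pow_eq_one hunit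
  have hGρ : G₀ = ρ * omega ^ i := by
    rw [hωi, mul_div_cancel₀ _ hρ0]
  -- the sector of G₀ is i
  have hψmem : ψ / 3 ∈ Set.Ioc (-(Real.pi / 3)) (Real.pi / 3) := by
    obtain ⟨h1, h2⟩ := Complex.arg_mem_Ioc π
    constructor <;> linarith
  have hargρ : arg ρ = ψ / 3 := by
    rw [hρdef, arg_real_mul _ hR, arg_exp_mul_I, toIocMod_eq_self]
    obtain ⟨h1, h2⟩ := hψmem
    have hπpos := Real.pi_pos
    constructor <;> linarith
  have hsec : arg (G₀ * omega⁻¹ ^ i) ∈ Set.Ioc (-(Real.pi / 3)) (Real.pi / 3) := by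
    have : G₀ * omega⁻¹ ^ i = ρ := by
      rw [hGρ, mul_assoc, ← mul_pow, mul_inv_cancel₀ (omega_isPrimitiveRoot.ne_zero (by norm_num)),
        one_pow, mul_one]
    rw [this, hargρ]
    exact hψmem
  have hki : k = i := by
    have := (kummerSectorIndex_eq_iff hG0 ⟨i, hi⟩).mpr hsec
    rw [← hk, this]
  -- assemble
  rw [hGρ, hki, hρdef, omega, ← Complex.exp_nat_mul, mul_assoc, ← Complex.exp_add]
  congr 1
  push_cast
  ring

/-- Adding two certified angles: from the polar form `G₀ = R e^{iα}` (`R > 0`), a `72`-grid index `n₃` for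
`α` to `±π/36` (modulo `2π`) and a `72`-grid index `n₂` for `arg (S · conj G₀)` to `±π/8`, the index
`(n₂ + n₃) mod 72` locates `arg S` to `±(π/36 + π/8) ≤ 1/2`. [folklore] -/
theorem arg_combination {S G₀ : ℂ} {R α : ℝ} (hR : 0 < R)
    (hG : G₀ = (R : ℂ) * exp ((α : ℂ) * I)) {n₂ n₃ : ℕ} {w : ℤ}
    (h3 : |α - 2 * Real.pi * n₃ / 72 + 2 * Real.pi * w| ≤ Real.pi / 36)
    (h2 : |arg (S * (starRingEnd ℂ) G₀ * exp (-(2 * Real.pi * I * (n₂ : ℂ) / 72)))| ≤ Real.pi / 8) :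
    |arg (S * exp (-(2 * Real.pi * I * (((n₂ + n₃) % 72 : ℕ) : ℂ) / 72)))| ≤ 1 / 2 := by
  have hπpos := Real.pi_pos
  set Z : ℂ := S * (starRingEnd ℂ) G₀ * exp (-(2 * Real.pi * I * (n₂ : ℂ) / 72)) with hZdef
  set β₃ : ℝ := α - 2 * Real.pi * n₃ / 72 + 2 * Real.pi * w with hβ₃def
  set γ : ℝ := arg Z + β₃ with hγdef
  have hγ : |γ| ≤ Real.pi / 36 + Real.pi / 8 := by
    have := abs_add_le (arg Z) β₃
    rw [hγdef]; linarith
  have hγ' : |γ| ≤ 1 / 2 := hγ.trans eleven_pi_div_le_half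
  -- conj G₀ * G₀ = R²
  have hGG : (starRingEnd ℂ) G₀ * G₀ = ((R ^ 2 : ℝ) : ℂ) := by
    rw [mul_comm, Complex.mul_conj, Complex.normSq_eq_norm_sq, hG, norm_mul, Complex.norm_real,
      Real.norm_eq_abs, abs_of_pos hR, Complex.norm_exp_ofReal_mul_I, mul_one]
  -- G₀ e(−n₃/72) = R e^{iβ₃}
  have hG3 : G₀ * exp (-(2 * Real.pi * I * (n₃ : ℂ) / 72)) = (R : ℂ) * exp ((β₃ : ℂ) * I) := by
    have hw : exp ((w : ℂ) * (2 * Real.pi * I)) = 1 := Complex.exp_int_mul_two_pi_mul_I w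
    rw [hG, mul_assoc, ← Complex.exp_add, hβ₃def]
    congr 1
    push_cast
    rw [show ((α : ℂ) - 2 * ↑Real.pi * (n₃ : ℂ) / 72 + 2 * ↑Real.pi * (w : ℂ)) * I
        = ((α : ℂ) * I + -(2 * ↑Real.pi * I * (n₃ : ℂ) / 72)) + (w : ℂ) * (2 * Real.pi * I) by ring,
      Complex.exp_add _ ((w : ℂ) * (2 * Real.pi * I)), hw, mul_one]
  -- the key product identity
  have hprod : S * exp (-(2 * Real.pi * I * ((n₂ + n₃ : ℕ) : ℂ) / 72)) * ((R ^ 2 : ℝ) : ℂ)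
      = ((‖Z‖ * R : ℝ) : ℂ) * exp ((γ : ℂ) * I) := by
    have hZpol : Z = (‖Z‖ : ℂ) * exp ((arg Z : ℂ) * I) := (norm_mul_exp_arg_mul_I Z).symm
    calc S * exp (-(2 * Real.pi * I * ((n₂ + n₃ : ℕ) : ℂ) / 72)) * ((R ^ 2 : ℝ) : ℂ)
        = (S * (starRingEnd ℂ) G₀ * exp (-(2 * Real.pi * I * (n₂ : ℂ) / 72)))
            * (G₀ * exp (-(2 * Real.pi * I * (n₃ : ℂ) / 72))) := by
          rw [← hGG]; push_cast; rw [show -(2 * ↑Real.pi * I * ((n₂ : ℂ) + (n₃ : ℂ)) / 72)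
              = -(2 * ↑Real.pi * I * (n₂ : ℂ) / 72) + -(2 * ↑Real.pi * I * (n₃ : ℂ) / 72) by ring,
              Complex.exp_add]; ring
      _ = Z * ((R : ℂ) * exp ((β₃ : ℂ) * I)) := by rw [← hZdef, hG3]
      _ = ((‖Z‖ * R : ℝ) : ℂ) * exp ((γ : ℂ) * I) := by
          conv_lhs => rw [hZpol]
          rw [hγdef]; push_cast
          rw [show (((arg Z : ℝ) : ℂ) + (β₃ : ℂ)) * I = (arg Z : ℂ) * I + (β₃ : ℂ) * I by ring,
            Complex.exp_add]; ring
  -- reduce the exponent mod 72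
  have hmod : exp (-(2 * Real.pi * I * (((n₂ + n₃) % 72 : ℕ) : ℂ) / 72))
      = exp (-(2 * Real.pi * I * ((n₂ + n₃ : ℕ) : ℂ) / 72)) := by
    have hq : exp ((((n₂ + n₃) / 72 : ℕ) : ℂ) * (2 * Real.pi * I)) = 1 :=
      Complex.exp_nat_mul_two_pi_mul_I _
    have hsplit : ((n₂ + n₃ : ℕ) : ℂ) = (((n₂ + n₃) % 72 : ℕ) : ℂ) + 72 * (((n₂ + n₃) / 72 : ℕ) : ℂ) := by
      exact_mod_cast (Nat.mod_add_div (n₂ + n₃) 72).symm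
    rw [hsplit, show -(2 * ↑Real.pi * I * ((((n₂ + n₃) % 72 : ℕ) : ℂ) + 72 * (((n₂ + n₃) / 72 : ℕ) : ℂ)) / 72)
        = -(2 * ↑Real.pi * I * (((n₂ + n₃) % 72 : ℕ) : ℂ) / 72)
          + -((((n₂ + n₃) / 72 : ℕ) : ℂ) * (2 * Real.pi * I)) by ring]
    rw [Complex.exp_add, Complex.exp_neg ((((n₂ + n₃) / 72 : ℕ) : ℂ) * (2 * Real.pi * I)), hq,
      inv_one, mul_one]
  rw [hmod]
  -- divide by R²
  have hR2 : (0 : ℝ) < R ^ 2 := by positivity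
  have hval : S * exp (-(2 * Real.pi * I * ((n₂ + n₃ : ℕ) : ℂ) / 72))
      = ((‖Z‖ * R / R ^ 2 : ℝ) : ℂ) * exp ((γ : ℂ) * I) := by
    have hR2c : ((R ^ 2 : ℝ) : ℂ) ≠ 0 := by exact_mod_cast hR2.ne'
    rw [(eq_div_iff hR2c).mpr hprod]
    push_cast
    ring
  rw [hval]
  rcases eq_or_lt_of_le (norm_nonneg Z) with hZ0 | hZpos
  · rw [← hZ0]; simp
  · have hc : 0 < ‖Z‖ * R / R ^ 2 := by positivity
    have hmem : γ ∈ Set.Ioc (-Real.pi) (-Real.pi + 2 * Real.pi) := by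
      have h1 := abs_le.mp hγ'
      constructor <;> nlinarith [Real.pi_gt_three]
    rw [arg_real_mul _ hc, arg_exp_mul_I, (toIocMod_eq_self _).2 hmem]
    exact hγ'

/-! ### Transport of the certified angle through the identity `12 p S = √3 G T` -/

/-- If `12·p·S = √3·G·T` and `G · conj G = p ≠ 0`, then `S · conj G = (√3/12) · T`, so the two have the same
argument after any common rotation. [folklore] -/
theorem arg_transfer {S G T E : ℂ} {p : ℕ} (hp : p ≠ 0)
    (hId : 12 * (p : ℂ) * S = (Real.sqrt 3 : ℂ) * G * T) (hGG : G * (starRingEnd ℂ) G = p) :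
    arg (S * (starRingEnd ℂ) G * E) = arg (T * E) := by
  have hp' : (12 : ℂ) * p ≠ 0 := mul_ne_zero (by norm_num) (by exact_mod_cast hp)
  have h1 : (12 : ℂ) * p * (S * (starRingEnd ℂ) G) = (12 : ℂ) * p * (((Real.sqrt 3 / 12 : ℝ) : ℂ) * T) := by
    calc (12 : ℂ) * p * (S * (starRingEnd ℂ) G) = 12 * (p : ℂ) * S * (starRingEnd ℂ) G := by ring
      _ = (Real.sqrt 3 : ℂ) * T * (G * (starRingEnd ℂ) G) := by rw [hId]; ring
      _ = (12 : ℂ) * p * (((Real.sqrt 3 / 12 : ℝ) : ℂ) * T) := by rw [hGG]; push_cast; ring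
  have h2 : S * (starRingEnd ℂ) G = ((Real.sqrt 3 / 12 : ℝ) : ℂ) * T := mul_left_cancel₀ hp' h1
  rw [h2, mul_assoc]
  exact arg_real_mul _ (by positivity)

/-! ### The assembly -/

/-- **`ArgLeg` from the four sub-cruxes**
`KummerSectorBQP → GaussCubePrimary → ArgIdentity → ArgLegClassicalBase → ArgLeg`
(the sub-cruxes are written out verbatim; they are the route's split children of `ArgLeg`). Proof: the
certified classical oracle algorithm of the fourth hypothesis lands in the `ArgLeg` relation — polar form of
the Gauss sum from the second hypothesis and the sector (`gaussSum_polar`), transport of the certified angle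
of `T_p` to `S_p · conj g(χ_p)` by the third hypothesis and `g · conj g = p` (`arg_transfer`), angle
addition (`arg_combination`) — the `ArgLeg` relation is closed under extension of the read-out, and the
classical-base principle `isQSolvable_of_mem_FPRel_BQP_holds` (BBBV 1997 Cor. 4.15 + BV 1997 Thm 8.3,
proved in the tree) applies with the oracle language `KummerSector ∈ BQP` of the first hypothesis.
[cite: BennettBernsteinBrassardVazirani1997, Cor. 4.15; VanDamSeroussi2002, Thm 1; IrelandRosen1990, Ch. 9 §4;
UrbanowiczWilliams2000, Ch. I Thm 2] -/
theorem ArgLeg_of_subs :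
    (Literature.NumberTheory.GaussSums.KummerSector ∈ Literature.Computability.Cryptography.BQP) →
    (∀ (p g : ℕ) (a b c d : ℤ), p.Prime → p % 3 = 1 → IsPrimitiveRoot (g : ZMod p) (p - 1) → a % 3 = 2 → b % 3 = 0 → a * a - a * b + b * b = (p : ℤ) → (((g ^ ((p - 1) / 3) % p : ℕ) : ℂ) - Literature.NumberTheory.GaussSums.omega = ((a : ℂ) + (b : ℂ) * Literature.NumberTheory.GaussSums.omega) * ((c : ℂ) + (d : ℂ) * Literature.NumberTheory.GaussSums.omega)) → Literature.NumberTheory.GaussSums.cubicGaussSum p g ^ 3 = (p : ℂ) * ((a : ℂ) + (b : ℂ) * Literature.NumberTheory.GaussSums.omega)) →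
    (∀ (p r g : ℕ), p.Prime → p % 3 = 1 → r < p → (r * r + r + 1) % p = 0 → 2 * r + 1 < p → IsPrimitiveRoot (g : ZMod p) (p - 1) → (g : ZMod p) ^ ((p - 1) / 3) = (r : ZMod p) → 12 * (p : ℂ) * (∑ j ∈ Finset.Icc 1 ((p - 1) / 3), (if (j : ZMod p) ^ ((p - 1) / 3) = 1 then (1 : ℂ) else if (j : ZMod p) ^ ((p - 1) / 3) = (r : ZMod p) then Complex.exp (2 * Real.pi * Complex.I / 3) else Complex.exp (2 * Real.pi * Complex.I / 3) ^ 2)) = (Real.sqrt 3 : ℂ) * Literature.NumberTheory.GaussSums.cubicGaussSum p g * ∑ a ∈ Finset.range (3 * p), ((if (a : ZMod p) = 0 then (0 : ℂ) else if (a : ZMod p) ^ ((p - 1) / 3) = 1 then 1 else if (a : ZMod p) ^ ((p - 1) / 3) = (r : ZMod p) then Complex.exp (2 * Real.pi * Complex.I / 3) ^ 2 else Complex.exp (2 * Real.pi * Complex.I / 3)) * (if a % 3 = 1 then (1 : ℂ) else if a % 3 = 2 then -1 else 0) * (Real.cot (Real.pi * a / (3 * p)) : ℂ))) →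
    (∃ G : List Bool → List Bool, G ∈ Literature.Computability.Complexity.FPRel (Literature.Computability.Complexity.Oracle.ofLanguage Literature.NumberTheory.GaussSums.KummerSector) ∧ ∃ q : Polynomial ℕ, ∀ x : List Bool, (3 : ℝ) / 4 ≤ Literature.Computability.Complexity.uniformProb (q.eval x.length) {c | G (Literature.Computability.Complexity.boolPair x c) ∈ {z : List Bool | ∀ p r : ℕ, Computability.decodeNat x = p → p.Prime → p % 3 = 1 → r < p → (r * r + r + 1) % p = 0 → 2 * r + 1 < p → ∃ (g k n₂ n₃ : ℕ) (a b u v w : ℤ), IsPrimitiveRoot (g : ZMod p) (p - 1) ∧ (g : ZMod p) ^ ((p - 1) / 3) = (r : ZMod p) ∧ (Literature.NumberTheory.GaussSums.kummerSectorIndex p g : ℕ) = k ∧ a % 3 = 2 ∧ b % 3 = 0 ∧ a * a - a * b + b * b = (p : ℤ) ∧ (((g ^ ((p - 1) / 3) % p : ℕ) : ℂ) - Literature.NumberTheory.GaussSums.omega = ((a : ℂ) + (b : ℂ) * Literature.NumberTheory.GaussSums.omega) * ((u : ℂ) + (v : ℂ) * Literature.NumberTheory.GaussSums.omega)) ∧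 |Complex.arg ((a : ℂ) + (b : ℂ) * Literature.NumberTheory.GaussSums.omega) / 3 + 2 * Real.pi * (k : ℝ) / 3 - 2 * Real.pi * (n₃ : ℝ) / 72 + 2 * Real.pi * (w : ℝ)| ≤ Real.pi / 36 ∧ |Complex.arg ((∑ a ∈ Finset.range (3 * p), ((if (a : ZMod p) = 0 then (0 : ℂ) else if (a : ZMod p) ^ ((p - 1) / 3) = 1 then 1 else if (a : ZMod p) ^ ((p - 1) / 3) = (r : ZMod p) then Complex.exp (2 * Real.pi * Complex.I / 3) ^ 2 else Complex.exp (2 * Real.pi * Complex.I / 3)) * (if a % 3 = 1 then (1 : ℂ) else if a % 3 = 2 then -1 else 0) * (Real.cot (Real.pi * a / (3 * p)) : ℂ))) * Complex.exp (-(2 * Real.pi * Complex.I * (n₂ : ℂ) / 72)))| ≤ Real.pi / 8 ∧ List.ofFn (fun i : Fin 7 => ((n₂ + n₃) % 72).testBit i.val) <+: z}}) →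
    Summit.QuantumAdvantage.QuantumAdvantage.Theses.ThirdFactorialPincer.ArgLeg := by
  intro h1 h2 h3 h4
  obtain ⟨G, hG, q, hq⟩ := h4
  unfold Summit.QuantumAdvantage.QuantumAdvantage.Theses.ThirdFactorialPincer.ArgLeg
  refine isQSolvable_of_mem_FPRel_BQP_holds _ G q _ ?_ h1 hG ?_
  · -- the `ArgLeg` relation is closed under extension of the read-out
    intro x y hy z hyz p r e1 e2 e3 e4 e5 e6
    obtain ⟨m, hm, harg, hpre⟩ := hy p r e1 e2 e3 e4 e5 e6
    exact ⟨m, hm, harg, hpre.trans hyz⟩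
  · intro x
    refine (hq x).trans (uniformProb_mono _ fun c hc => ?_)
    simp only [Set.mem_setOf_eq] at hc ⊢
    intro p r e1 e2 e3 e4 e5 e6
    obtain ⟨g, k, n₂, n₃, a, b, u, v, w, hg, hu, hk, ha, hb, hN, hdiv, hcert3, hcert2, hpre⟩ :=
      hc p r e1 e2 e3 e4 e5 e6
    haveI : Fact p.Prime := ⟨e2⟩
    have hcube := h2 p g a b u v e2 e3 hg ha hb hN hdiv
    have hG0 : cubicGaussSum p g ≠ 0 := cubicGaussSum_ne_zero e3 hg
    have hπ0 : ((a : ℂ) + (b : ℂ) * omega) ≠ 0 := by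
      intro h0
      rw [h0, mul_zero] at hcube
      exact pow_ne_zero 3 hG0 hcube
    have hpolar := gaussSum_polar e3 hg hπ0 hcube hk
    have hId := h3 p r g e2 e3 e4 e5 e6 hg hu
    have htrans := arg_transfer (E := Complex.exp (-(2 * Real.pi * Complex.I * (n₂ : ℂ) / 72)))
      e2.ne_zero hId (cubicGaussSum_mul_conj e3 hg)
    rw [← htrans] at hcert2
    refine ⟨(n₂ + n₃) % 72, Nat.mod_lt _ (by norm_num), ?_, hpre⟩
    exact arg_combination (norm_pos_iff.mpr hG0) hpolar hcert3 hcert2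

end Summit.QuantumAdvantage.QuantumAdvantage.Theorems.ThirdFactorialPincer
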